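import Summits.AtomisticToContinuum.Crystallization.Theorems.ChartedZeroExcessLayeredLatticeLiouvilleZZZYRCXRWA
import Summits.AtomisticToContinuum.Crystallization.Theorems.ChartedZeroExcessLayeredLatticeLiouvilleZZZYRCZZ

/-!
# ZZZYRCXRWE — THE READER AND THE HOLLOW-CELL K-FILE TEMPLATE ON EXISTENTIAL KERNEL DATA
(binder 26636, line (D); lens-2 g101; critic r1907 (B3) lemma (L3) «door variant»; consumers = census K-files, hand-1's type assembly ZZZYRCXRWD)

The reader of record (ZZZYRCZW `thetaReaderNearF_holds`) and the hollow-cell K-file template (ZZZYRCZZ `boxTailDebitP_of_inBoxWH`) take, per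
hollow window type `ω`, an EXACT kernel certificate `KernelSlabSoundF H₀ R ω … (cdOf ω) TRX TNX` with the chord data `cdOf ω` named.  The
data never reach the conclusion: `BoxTailDebitP` speaks of the offset TABLES only.  Symmetry-transported certificates (ZZZYRCXRW, ZZZYRCXRWD) have data
depending on the out-of-window letters, i.e. they prove the EXISTENTIAL-DATA contract `KernelSlabSoundFE H₀ R ω … TRX TNX` (ZZZYRCXRWA).  This
file re-issues the three doors on that input, with IDENTICAL conclusions:
* `exists_windowDataF_of_typesE` (window data chosen per base layer by `choose`), `thetaReaderNearF_of_typesE` (∃ data, path system + offset-table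
  domination on the far ideal-near pairs), `nearF_of_inBoxWH_E` (per word of a hollow cell);
* ★★★ `boxTailDebitP_of_inBoxWH_E` — ZZZYRCZZ `boxTailDebitP_of_inBoxWH` VERBATIM except `hT` (now `KernelSlabSoundFE`, no `cdOf`): same numerics,
  same Ξ slabs, same far-far inequality, SAME CONCLUSION `BoxTailDebitP s Λ c₀ ℓ₀ ϱ (InBoxWH …) ΘR ΘN 0` with the word-independent tables.
An exact certificate still serves (`kernelSlabSoundFE_of_F`).  Imports ZZZYRCXRWA, ZZZYRCZZ; no instance / notation / option; 0 sorry. [g101]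
-/

namespace Summit.AtomisticToContinuum.Crystallization.Theorems.ChartedZeroExcessLayeredLatticeLiouville

open scoped BigOperators RealInnerProductSpace
open Summit.AtomisticToContinuum.Crystallization.Theorems.ChartedPlanarOrderRigidityDoor (E3)

/-! ### §1 window data and the reader on existential-data type certificates -/

/-- ★ WINDOW DATA FROM EXISTENTIAL-DATA TYPE CERTIFICATES: for a letter sequence whose window types are admitted, SOME window data with the
dyadic majorants of the one table pair (the data of base layer `m` are those the certificate of the type of window `m` yields at the re-based
sequence `winSeq ℓ H₀ m`). [g101] -/
theorem exists_windowDataF_of_typesE {H₀ R : ℕ} {ℓ : ℤ → ℤ} {lo hi P9max : ℤ} {E : ℕ} {TRX TNX : ℤ × ℤ × ℤ × ℤ → ℤ}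
    {Adm : List ℤ → Prop} (hℓ : IsLetterSeq ℓ) (hwin : ∀ m : ℤ, Adm (windowWord ℓ (m - H₀) (2 * H₀ + 1)))
    (hT : ∀ ω : List ℤ, ω.length = 2 * H₀ + 1 → IsLetterSeq (regW ω) → Adm ω → KernelSlabSoundFE H₀ R ω lo hi P9max E TRX TNX) :
    ∃ cdW : ℤ → List ChordDatum,
      WindowDataF H₀ R ℓ lo hi P9max cdW (fun _ k => (TRX k : ℝ) / 2 ^ E) fun _ k => (TNX k : ℝ) / 2 ^ E := by
  have hag : ∀ m : ℤ, AgreesOnWindow H₀ (windowWord ℓ (m - H₀) (2 * H₀ + 1)) (winSeq ℓ H₀ m) := fun m => by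
    intro j h0 hj
    unfold winSeq
    rw [regW_windowWord ℓ (m - H₀) h0 (by push_cast; omega)]
    congr 1; ring
  choose cdW hcd using fun m : ℤ => hT _ (windowWord_length ℓ (m - H₀) (2 * H₀ + 1))
    (isLetterSeq_regW_windowWord hℓ (m - H₀) (2 * H₀ + 1)) (hwin m) (winSeq ℓ H₀ m) (isLetterSeq_winSeq hℓ H₀ m) (hag m)
  exact ⟨cdW, fun m => hcd m⟩

/-- the same with TYPE-DEPENDENT table pairs `TRof ω, TNof ω` (per-class tables; the reader ZZZYRCZW `thetaReaderNearF_holds` then dominates by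
the base-layer sums `thetaSumR/thetaSumN` of the window-dependent tables). [g101] -/
theorem exists_windowDataF_of_typesE' {H₀ R : ℕ} {ℓ : ℤ → ℤ} {lo hi P9max : ℤ} {E : ℕ} {TRof TNof : List ℤ → ℤ × ℤ × ℤ × ℤ → ℤ}
    {Adm : List ℤ → Prop} (hℓ : IsLetterSeq ℓ) (hwin : ∀ m : ℤ, Adm (windowWord ℓ (m - H₀) (2 * H₀ + 1)))
    (hT : ∀ ω : List ℤ, ω.length = 2 * H₀ + 1 → IsLetterSeq (regW ω) → Adm ω →
      KernelSlabSoundFE H₀ R ω lo hi P9max E (TRof ω) (TNof ω)) :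
    ∃ cdW : ℤ → List ChordDatum, WindowDataF H₀ R ℓ lo hi P9max cdW
      (fun m k => (TRof (windowWord ℓ (m - H₀) (2 * H₀ + 1)) k : ℝ) / 2 ^ E)
      fun m k => (TNof (windowWord ℓ (m - H₀) (2 * H₀ + 1)) k : ℝ) / 2 ^ E := by
  have hag : ∀ m : ℤ, AgreesOnWindow H₀ (windowWord ℓ (m - H₀) (2 * H₀ + 1)) (winSeq ℓ H₀ m) := fun m => by
    intro j h0 hj
    unfold winSeq
    rw [regW_windowWord ℓ (m - H₀) h0 (by push_cast; omega)]
    congr 1; ring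
  choose cdW hcd using fun m : ℤ => hT _ (windowWord_length ℓ (m - H₀) (2 * H₀ + 1))
    (isLetterSeq_regW_windowWord hℓ (m - H₀) (2 * H₀ + 1)) (hwin m) (winSeq ℓ H₀ m) (isLetterSeq_winSeq hℓ H₀ m) (hag m)
  exact ⟨cdW, fun m => hcd m⟩

/-- ★★ THE WINDOWED READER WITH OFFSET TABLES on existential-data type certificates: SOME window data whose path system is a path system on the
far ideal-near pairs with the scheme dominated by the WORD-INDEPENDENT offset tables (ZZZYRCZY `thetaReaderNearF_of_types`, ∃ form). [g101] -/
theorem thetaReaderNearF_of_typesE {H₀ R : ℕ} {ℓ : ℤ → ℤ} {lo hi P9max : ℤ} {E : ℕ} {TRX TNX : ℤ × ℤ × ℤ × ℤ → ℤ}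
    {Adm : List ℤ → Prop} {ϱ α lam mu K η : ℝ} {a b : E3} {w : ℤ → E3} (hℓ : IsLetterSeq ℓ)
    (hwin : ∀ m : ℤ, Adm (windowWord ℓ (m - H₀) (2 * H₀ + 1))) (hϱ : 0 ≤ ϱ) (hα : 0 < α) (hlam : 0 < lam) (hK0 : 0 ≤ K) (hη : 0 ≤ η)
    (hT : ∀ ω : List ℤ, ω.length = 2 * H₀ + 1 → IsLetterSeq (regW ω) → Adm ω → KernelSlabSoundFE H₀ R ω lo hi P9max E TRX TNX)
    (hL : IdealLengthCmpF ℓ lam mu a b w) (hA : IdealAngleCmpF ℓ K η a b w) (hP9 : mu ^ 2 * (P9max : ℝ) ≤ 9 * ϱ ^ 2)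
    (hlo : mu ^ 2 * (lo : ℝ) ≤ 9 * ϱ ^ 2) :
    ∃ cdW : ℤ → List ChordDatum, IsPathSystemOn ϱ a b w (IdealNearF ℓ hi) (dataNpF H₀ cdW) (dataZF H₀ cdW) ∧
      SchemeDominatedOnP ϱ α a b w (dataNpF H₀ cdW) (dataZF H₀ cdW) (IdealNearF ℓ hi)
        (fun y => (1 + α) * (lam ^ 8)⁻¹ * offsetSumF H₀ R (fun k => (TRX k : ℝ) / 2 ^ E) (y.2 - y.1))
        fun y => (1 + α⁻¹) * (lam ^ 8)⁻¹ * offsetSumF H₀ R (fun k => K * ((TNX k : ℝ) / 2 ^ E) + η * ((TRX k : ℝ) / 2 ^ E)) (y.2 - y.1) := by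
  obtain ⟨cdW, hW⟩ := exists_windowDataF_of_typesE hℓ hwin hT
  have h := thetaReaderNearF_holds hϱ hα hlam hK0 hη hW hL hA hP9 hlo
  have e₁ : (thetaSumR H₀ R α lam fun _ k => (TRX k : ℝ) / 2 ^ E) =
      fun y => (1 + α) * (lam ^ 8)⁻¹ * offsetSumF H₀ R (fun k => (TRX k : ℝ) / 2 ^ E) (y.2 - y.1) :=
    funext fun y => thetaSumR_const H₀ R α lam _ y
  have e₂ : (thetaSumN H₀ R α lam K η (fun _ k => (TRX k : ℝ) / 2 ^ E) fun _ k => (TNX k : ℝ) / 2 ^ E) =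
      fun y => (1 + α⁻¹) * (lam ^ 8)⁻¹ * offsetSumF H₀ R (fun k => K * ((TNX k : ℝ) / 2 ^ E) + η * ((TRX k : ℝ) / 2 ^ E)) (y.2 - y.1) :=
    funext fun y => thetaSumN_const H₀ R α lam K η _ _ y
  rw [e₁, e₂] at h
  exact ⟨cdW, h⟩

/-! ### §2 the hollow cell: NEAR and the K-file template on existential-data certificates -/

/-- ★ NEAR, per word of the hollow cell, on existential-data per-hollow-type certificates: SOME near path system on `IdealNearF (letterOfWH …) hi`
dominated by the offset tables (ZZZYRCZZ `nearF_of_inBoxWH`, ∃ form). [g101] -/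
theorem nearF_of_inBoxWH_E {s aLo aHi τ hLo hHi lam mu β Ka ηa ϱ α : ℝ} {H₀ R E : ℕ} {lo hi P9max : ℤ}
    {TRX TNX : ℤ × ℤ × ℤ × ℤ → ℤ}
    (haLo : 0 < aLo) (hs0 : 0 ≤ s) (hs1 : s < 1) (hτ : 0 ≤ τ) (hhLo : 0 ≤ hLo) (hhHi : 0 ≤ hHi)
    (hA : lam ^ 2 < (1 - s) ^ 2 * aLo ^ 2)
    (hAC : (1 - s) ^ 2 * τ ^ 2 * aLo ^ 4 ≤ ((1 - s) ^ 2 * aLo ^ 2 - lam ^ 2) * ((τ ^ 2 + hLo ^ 2) * aLo ^ 2 - 2 / 3 * lam ^ 2))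
    (hC2 : lam ^ 2 * (τ ^ 2 + 2 / 3 * (1 - s) ^ 2) ≤ hLo ^ 2 * (1 - s) ^ 2 * aLo ^ 2) (hA' : (1 + s) ^ 2 * aHi ^ 2 < mu ^ 2)
    (hAC' : (1 + s) ^ 2 * τ ^ 2 * aHi ^ 4 ≤ (mu ^ 2 - (1 + s) ^ 2 * aHi ^ 2) * (2 / 3 * mu ^ 2 - (τ ^ 2 + hHi ^ 2) * aHi ^ 2))
    (hΔ : hLo ≤ hHi) (hhb : 3 * (hLo + hHi) ^ 2 ≤ 8 * (1 + s) ^ 2) (hlam : 0 < lam) (hβ : 0 < β)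
    (hKa : (1 + β) * ((1 + s) * aHi / lam) ^ 2 ≤ Ka) (hηa : 6 * (1 + β⁻¹) * (aHi / lam) ^ 2 * (τ ^ 2 + (hHi - hLo) ^ 2 / 4) ≤ ηa)
    (hϱ : 0 ≤ ϱ) (hα : 0 < α)
    (hT : ∀ ω : List ℤ, ω.length = 2 * H₀ + 1 → IsLetterSeq (regW ω) → IsHollowWindow (2 * H₀ + 1) ω →
      KernelSlabSoundFE H₀ R ω lo hi P9max E TRX TNX)
    (hP9 : mu ^ 2 * (P9max : ℝ) ≤ 9 * ϱ ^ 2) (hlo : mu ^ 2 * (lo : ℝ) ≤ 9 * ϱ ^ 2) {L : E3 ≃L[ℝ] E3} {w' : ℤ → E3}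
    (hB : InBoxWH s aLo aHi τ hLo hHi L w') :
    ∃ (np : (Cell 2 × ℤ) × (Cell 2 × ℤ) → ℕ) (z : (Cell 2 × ℤ) × (Cell 2 × ℤ) → ℕ → Cell 2 × ℤ),
      IsPathSystemOn ϱ (gen₁ L) (gen₂ L) w' (IdealNearF (letterOfWH s aLo aHi τ hLo hHi L w') hi) np z ∧
        SchemeDominatedOnP ϱ α (gen₁ L) (gen₂ L) w' np z (IdealNearF (letterOfWH s aLo aHi τ hLo hHi L w') hi)
          (fun y => nearTableR H₀ R E α lam TRX (y.2 - y.1)) fun y => nearTableN H₀ R E α lam Ka ηa TRX TNX (y.2 - y.1) := by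
  obtain ⟨hℓ, hH, hbox⟩ := letterOfWH_spec hB
  have hL := idealLengthCmpF_of_slabBoxF hbox haLo hs0 hs1 hτ hhLo hhHi hA hAC hC2 hA' hAC'
  have hAng := idealAngleCmpF_mono hKa hηa (idealAngleCmpF_of_slabBoxF hbox hL haLo.le hs0 hΔ hhb hlam hβ)
  have hK0 : 0 ≤ Ka := le_trans (by positivity) hKa
  have hη0 : 0 ≤ ηa := le_trans (by positivity) hηa
  obtain ⟨cdW, h⟩ :=
    thetaReaderNearF_of_typesE hℓ (fun m => isHollowWindow_windowWord hH _ _) hϱ hα hlam hK0 hη0 hT hL hAng hP9 hlo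
  exact ⟨_, _, h⟩

/-- ★★★ **THE HOLLOW-CELL K-FILE TEMPLATE ON EXISTENTIAL-DATA CERTIFICATES** — ZZZYRCZZ `boxTailDebitP_of_inBoxWH` with the per-hollow-type kernel
input weakened to `KernelSlabSoundFE` (what ZZZYRCXRWD `kernelSlabSoundFE_of_units` delivers from hand-1's class-representative units); every
other hypothesis and the CONCLUSION are unchanged (the near data are chosen per word, inside the proof). [g101] -/
theorem boxTailDebitP_of_inBoxWH_E {s Λ c₀ ℓ₀ aLo aHi τ hLo hHi lam mu β Ka ηa ϱ α D θ cB : ℝ} {H₀ R E : ℕ} {lo hi P9max : ℤ}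
    {TRX TNX : ℤ × ℤ × ℤ × ℤ → ℤ} {Kx HI1 HI2 Gb Mm nr nD n₁ : ℕ} {yLo : ℤ}
    (hc : 0 < c₀) (hϱ1 : 1 ≤ ϱ) (hα : 0 < α) (hD : 0 < D) (hcB : 0 < cB) (hcB2 : 2 * cB ^ 2 ≤ lam ^ 2)
    (haLo : 0 < aLo) (hs0 : 0 ≤ s) (hs1 : s < 1) (hτ : 0 ≤ τ) (hhLo : 0 ≤ hLo) (hhHi : 0 ≤ hHi)
    (hA : lam ^ 2 < (1 - s) ^ 2 * aLo ^ 2)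
    (hAC : (1 - s) ^ 2 * τ ^ 2 * aLo ^ 4 ≤ ((1 - s) ^ 2 * aLo ^ 2 - lam ^ 2) * ((τ ^ 2 + hLo ^ 2) * aLo ^ 2 - 2 / 3 * lam ^ 2))
    (hC2 : lam ^ 2 * (τ ^ 2 + 2 / 3 * (1 - s) ^ 2) ≤ hLo ^ 2 * (1 - s) ^ 2 * aLo ^ 2) (hA' : (1 + s) ^ 2 * aHi ^ 2 < mu ^ 2)
    (hAC' : (1 + s) ^ 2 * τ ^ 2 * aHi ^ 4 ≤ (mu ^ 2 - (1 + s) ^ 2 * aHi ^ 2) * (2 / 3 * mu ^ 2 - (τ ^ 2 + hHi ^ 2) * aHi ^ 2))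
    (hΔ : hLo ≤ hHi) (hhb : 3 * (hLo + hHi) ^ 2 ≤ 8 * (1 + s) ^ 2) (hlam : 0 < lam) (hβ : 0 < β)
    (hKa : (1 + β) * ((1 + s) * aHi / lam) ^ 2 ≤ Ka) (hηa : 6 * (1 + β⁻¹) * (aHi / lam) ^ 2 * (τ ^ 2 + (hHi - hLo) ^ 2 / 4) ≤ ηa)
    (hgen : 2 * ((1 + s) * aHi) + ℓ₀ ≤ ϱ)
    (hT : ∀ ω : List ℤ, ω.length = 2 * H₀ + 1 → IsLetterSeq (regW ω) → IsHollowWindow (2 * H₀ + 1) ω →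
      KernelSlabSoundFE H₀ R ω lo hi P9max E TRX TNX)
    (hP9 : mu ^ 2 * (P9max : ℝ) ≤ 9 * ϱ ^ 2) (hlo : mu ^ 2 * (lo : ℝ) ≤ 9 * ϱ ^ 2)
    (hKx : 0 < Kx) (slabs : List (ℤ × List (List (ℕ × ℕ)) × List ℕ))
    (hsl : ∀ sl ∈ slabs, xiSlab Kx HI1 HI2 sl.1 yLo sl.2.1 = some sl.2.2 ∧ ∀ c ∈ sl.2.1, c.length = nr)
    (hG : 4 * HI2 < 3 * (3 * (Gb + 1) - 2) ^ 2) (hM : HI2 < 6 * (Mm + 1) * (Mm + 1))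
    (hy : ∀ t : ℤ, t.natAbs ≤ Gb → yLo ≤ t ∧ t < yLo + nr)
    (hx : ∀ t : ℤ, t.natAbs ≤ Gb → ∃ sl ∈ slabs, sl.1 ≤ t ∧ t < sl.1 + sl.2.1.length)
    (h1 : (HI1 : ℤ) ≤ hi) (h2 : 9 * D ^ 2 ≤ lam ^ 2 * (HI2 : ℝ))
    (hnD : (nD : ℝ) - 1 ≤ D / ϱ) (hn2 : 2 ≤ n₁) (hnD₁ : nD ≤ n₁)
    (hθ : ∑ n ∈ Finset.Ico nD n₁, (2 * (n : ℝ) * (n + 1) * (2 * n + 1) / 3) * (7 * (n : ℝ) / D ^ 8) +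
        14 * ((n₁ : ℝ) + 1) * (2 * n₁ + 1) / (9 * cB ^ 8 * (n₁ : ℝ) ^ 2 * ((n₁ : ℝ) - 1) ^ 3) ≤ θ) :
    BoxTailDebitP s Λ c₀ ℓ₀ ϱ (InBoxWH s aLo aHi τ hLo hHi)
      (fun _ _ y => nearTableR H₀ R E α lam TRX (y.2 - y.1) +
        (1 + α) * (lam ^ 8)⁻¹ * (45927 / Kx * (slabs.map fun sl => (sl.2.2.getD (code3 (y.2 - y.1)) 0 : ℝ)).sum) + (1 + α) * θ)
      (fun _ _ y => nearTableN H₀ R E α lam Ka ηa TRX TNX (y.2 - y.1) +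
        (1 + α⁻¹) * (lam ^ 8)⁻¹ * (45927 / Kx * (slabs.map fun sl => (sl.2.2.getD (code3 (y.2 - y.1)) 0 : ℝ)).sum) + (1 + α⁻¹) * θ)
      0 := by
  have hϱ0 : 0 < ϱ := one_pos.trans_le hϱ1
  have key : ∀ (L : E3 ≃L[ℝ] E3) (w' : ℤ → E3),
      ∃ npz : ((Cell 2 × ℤ) × (Cell 2 × ℤ) → ℕ) × ((Cell 2 × ℤ) × (Cell 2 × ℤ) → ℕ → Cell 2 × ℤ),
        InBoxWH s aLo aHi τ hLo hHi L w' →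
          IsPathSystemOn ϱ (gen₁ L) (gen₂ L) w' (IdealNearF (letterOfWH s aLo aHi τ hLo hHi L w') hi) npz.1 npz.2 ∧
            SchemeDominatedOnP ϱ α (gen₁ L) (gen₂ L) w' npz.1 npz.2 (IdealNearF (letterOfWH s aLo aHi τ hLo hHi L w') hi)
              (fun y => nearTableR H₀ R E α lam TRX (y.2 - y.1)) fun y => nearTableN H₀ R E α lam Ka ηa TRX TNX (y.2 - y.1) := by
    intro L w'
    by_cases hB : InBoxWH s aLo aHi τ hLo hHi L w'
    · obtain ⟨np, z, h⟩ := nearF_of_inBoxWH_E haLo hs0 hs1 hτ hhLo hhHi hA hAC hC2 hA' hAC' hΔ hhb hlam hβ hKa hηa hϱ0.le hα hT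
        hP9 hlo hB
      exact ⟨(np, z), fun _ => h⟩
    · exact ⟨(fun _ => 0, fun _ _ => (fun _ => 0, 0)), fun h => absurd h hB⟩
  choose npz hnpz using key
  exact boxTailDebitP_of_scheme hϱ1 hα hc
    (boxSchemeP_of_cover3FBox hα hcB hϱ0 hD hnD hn2 hnD₁ hθ (letterOfWH s aLo aHi τ hLo hHi) hi
      (np₁ := fun L w' => (npz L w').1) (z₁ := fun L w' => (npz L w').2)
      (fun L w' hB => gen_sum_le_of_inBoxWH haLo.le hs0 hgen hB)
      (fun a _ L w' _ hB => isLayeredCrystal_of_inBoxW (inBoxW_of_inBoxWH hB) hcB.le hcB2 haLo hs0 hs1 hτ hhLo hhHi hA hAC hC2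
        hA' hAC')
      (fun a _ L w' _ hB => hnpz L w' hB)
      (fun a _ L w' _ hB => midF_of_inBoxWH (ϱ := ϱ) haLo hs0 hs1 hτ hhLo hhHi hA hAC hC2 hA' hAC' hlam hα hKx slabs hsl hG hM hy hx
        h1 h2 hB))

/-- the exact-certificate template of record is the special case (ZZZYRCXRWA `kernelSlabSoundFE_of_F`). [g101] -/
example {H₀ R E : ℕ} {lo hi P9max : ℤ} {cdOf : List ℤ → List ChordDatum} {TRX TNX : ℤ × ℤ × ℤ × ℤ → ℤ}
    (hT : ∀ ω : List ℤ, ω.length = 2 * H₀ + 1 → IsLetterSeq (regW ω) → IsHollowWindow (2 * H₀ + 1) ω →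
      KernelSlabSoundF H₀ R ω lo hi P9max E (cdOf ω) TRX TNX) :
    ∀ ω : List ℤ, ω.length = 2 * H₀ + 1 → IsLetterSeq (regW ω) → IsHollowWindow (2 * H₀ + 1) ω →
      KernelSlabSoundFE H₀ R ω lo hi P9max E TRX TNX :=
  fun ω h1 h2 h3 => kernelSlabSoundFE_of_F (hT ω h1 h2 h3)

end Summit.AtomisticToContinuum.Crystallization.Theorems.ChartedZeroExcessLayeredLatticeLiouville
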